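import Summits.ResolutionOfSingularities.ResolutionOfSingularities.Theorems.HilbertSamuelEliminationSigmaMaxModificationsCorridor3WLadderStrataBirthsTopDictionaryGraded
import Summits.ResolutionOfSingularities.ResolutionOfSingularities.Theorems.HilbertSamuelEliminationSigmaMaxModificationsCorridor3WLadderStrataKernels
import HarnessLib

/-!
# [OURS · L1 W4.2] (b-end)₃ W-TOP BIRTHS — D9 CLOSING COMPOSITION: the row `StrataCycleEndBirthsSettle p 3 (QNe Q) (3 ≤ ē)` from the
# BIRTH DICTIONARY, the no-recurrent-RULED-birth claim, the cycle-end centre dichotomy and the MOVING-births row (D13)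
# (cell res-hironaka, LADDER-RESOLUTION rung L; slot W4.2, crux chain w42 `SigmaMaxModificationsCorridor3`
# stmt-ResolutionOfSingularities-19249; `--supports stmt-ResolutionOfSingularities-19249 --as helper`; res-L1-w42-plan-1 W4.2 DEAL D9 /
# RULINGS v3.12-1 (C), v3.12-2 (J2); hand res-D-pv-002; dictionary typer res-type-067)

Everything here is OURS bookkeeping over res-type-067's BIRTH DICTIONARY (`…StrataBirthsTopDictionary.lean` p513551: birth events,
rows `StrataCycleEndNoFibreBirths` / `StrataCycleEndNoMovingBirths`, join `strataCycleEndBirthsSettle_of_noFibre_noMoving`;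
`…StrataBirthsTopDictionaryGraded.lean`: `not_isFibreBirthAt_of_subsingleton_nearFibre`, `BirthDictionary3`, `NoRuledBirth3`,
`CycleEndCentreDichotomy3`) and stub-4's strata kit (`exists_cycleInv_chain'`, `CycleInv.singleton_notMem_componentsIn_of_not_iso`,
`reaches_chain`, `chain_geomDirDim_le`). NOT a statement of Hironaka's manuscript [Hironaka2017] nor of [CossartJannsenSaito2020]; no
`Literature.…` named fact; never a `Theses/…` import. The three OURS CLAIMS it consumes (dictionary, no recurrent ruled births, dichotomy)
are HYPOTHESES — named second-layer constructions under `stub_Wtop3M_nonpointed`, not hidden steps (plan-1 (J2)). AI-written; no expert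
review; AI review is weaker than expert review.

## What is proved

* `not_isFibreBirthAt_eventually_of_dictionary` — the ROBUST form (RULINGS v3.12-4 (X)): for ANY stage predicate `H`, if the cycle-end
  centre dichotomy holds at `H`-stages, then along every moving never-isolated W-top chain living in `H` there are eventually no fibre
  births at blown-up cycle-end steps (`BirthDictionary3` + `NoRuledBirth3` in the curve branch, `not_isFibreBirthAt_of_subsingleton_nearFibre`
  in the surface branch). `H := IsHypStage` (typer's re-cut) gives the hypersurface cell of (X3) by a one-line instance.
* `strataCycleEndNoFibreBirths_three_of_dictionary` — `BirthDictionary3 p → NoRuledBirth3 p → CycleEndCentreDichotomy3 p →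
  StrataCycleEndNoFibreBirths p 3 Q (fun s => 3 ≤ s.geomDirDim)` for EVERY scope `Q`: at a late blown-up cycle-end step, if the centre germ
  at `x_n` is a CURVE (a centre-adapted CP frame exists) a fibre birth would hand that frame the ruled-birth datum (dictionary), which the
  no-recurrence claim forbids from stage `n₁` on; if it is a SURFACE (near fibre over `x_n` a subsingleton) there is no fibre birth at all
  (`not_isFibreBirthAt_of_subsingleton_nearFibre`, `{x_{n+1}}` not a component because the chain is never isolated — `CycleInv` from
  `exists_cycleInv_chain'`). `ē(x_n) = 3` from `3 ≤ ē ≤ N = 3` (`chain_geomDirDim_le`).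
* `strataCycleEndBirthsSettle_three_of_dictionary` — **D9 CLOSE**: the above ∧ the MOVING-births row (D13's target, a hypothesis
  `∀ Q`-free: taken at the same `Q`) ⇒ `StrataCycleEndBirthsSettle p 3 Q (fun s => 3 ≤ s.geomDirDim)` by 067's join; and the `QNe Q`
  instance `strataCycleEndBirthsSettle_three_of_noRuled_noMoving` in the exact shape of RULINGS v3.12-2 (J2).
-/

noncomputable section

set_option linter.dupNamespace false

open CategoryTheory AlgebraicGeometry TopologicalSpace Topology Polynomial
open Summit.ResolutionOfSingularities.ResolutionOfSingularities.Theorems.CampaignW42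
open Literature.AlgebraicGeometry.Resolution Literature.RingTheory.HilbertSamuel
open Summit.ResolutionOfSingularities.ResolutionOfSingularities.Theorems.SigmaMaxModificationsCorridor3

namespace Summit.ResolutionOfSingularities.ResolutionOfSingularities.Theorems.SigmaMaxModificationsCorridor3.Moving

universe u

/-- [OURS · L1 W4.2] **NO LATE FIBRE BIRTHS at W-top along chains inside a stage predicate `H`** — the composition in its
ROBUST form (RULINGS v3.12-4 (X): the cycle-end centre dichotomy is only claimed at HYPERSURFACE stages; here `H` is ANY stage predicate
and the dichotomy is assumed only at stages satisfying `H`, the conclusion being the row body of `StrataCycleEndNoFibreBirths p 3 Q (3 ≤ ē)`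
for chains living in `H`). With `H := fun _ => True` it is the named composition below; with `H :=` «formal hypersurface stage» (the typer's
`IsHypStage`, RULINGS v3.12-4 (X1)) it is the hypersurface cell of (X3). NOT a statement of the manuscript. [folklore] -/
theorem not_isFibreBirthAt_eventually_of_dictionary {p : ℕ} (hdict : BirthDictionary3.{u} p) (hrec : NoRuledBirth3.{u} p)
    (H : MarkedStage.{u} → Prop)
    (hdich : ∀ (R : ∀ S : Scheme.{u}, CentreSeq S → Prop), OracleFunctional R → OracleAdmissible R →
      ∀ (ν : ℕ → ℕ) (X : Scheme.{u}) [IsLocallyNoetherian X] (x : X), IsMaximalOrigin p 3 ν X x →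
      ∀ c : ℕ → MarkedStage.{u}, Reaches R 3 ν (MarkedStage.init X x) (c 0) →
        (∀ n, CanonicalNearStep R 3 ν (c n) (c (n + 1))) → (∀ n, 3 ≤ (c n).geomDirDim) → (∀ n, ¬ Iso 3 (c n)) →
        ∀ n, (c n).IsBlownUp R 3 ν → (c (n + 1)).P = none → H (c n) →
          (∃ (C : (c n).W.IdealSheafData) (P' : Option (Pending (blowup C))) (Rf : Type) (_ : CommRing Rf) (u : Fin 3 → Rf)
              (h : Rf[X]) (φ : ((c n).W.presheaf.stalk (c n).pt : Type u) →+* Rf[X] ⧸ Ideal.span {h}),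
              IsCanonicalStep R 3 ν (c n).L (c n).P C P' ∧ IsCPFrameAlong (c n) C Rf u h φ) ∨
          (∀ f : (c (n + 1)).W ⟶ (c n).W, StepProjection R 3 ν (c n) (c (n + 1)) f →
              (f.base ⁻¹' {(c n).pt} ∩ Scheme.hsStratum (c (n + 1)).W 3 ν).Subsingleton))
    {R : ∀ S : Scheme.{u}, CentreSeq S → Prop} (hRf : OracleFunctional R) (hRa : OracleAdmissible R)
    {ν : ℕ → ℕ} {X : Scheme.{u}} [IsLocallyNoetherian X] {x : X} (hX : IsMaximalOrigin p 3 ν X x)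
    {c : ℕ → MarkedStage.{u}} (h0 : Reaches R 3 ν (MarkedStage.init X x) (c 0))
    (hstep : ∀ n, CanonicalNearStep R 3 ν (c n) (c (n + 1))) (hG : ∀ n, 3 ≤ (c n).geomDirDim) (hnI : ∀ n, ¬ Iso 3 (c n))
    (hmov : ∀ n, ∃ m, n ≤ m ∧ (c m).IsBlownUp R 3 ν) (hH : ∀ n, H (c n)) :
    ∃ n₁, ∀ n, n₁ ≤ n → (c n).IsBlownUp R 3 ν → (c (n + 1)).P = none →
      ∀ f : (c (n + 1)).W ⟶ (c n).W, StepProjection R 3 ν (c n) (c (n + 1)) f →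
        ∀ Z', ¬ IsFibreBirthAt 3 ν (c n) (c (n + 1)) f Z' := by
  obtain ⟨_, k, _, hinv⟩ := exists_cycleInv_chain' hRf hRa hX h0 hstep
  obtain ⟨n₁, hn₁⟩ := hrec R hRf hRa ν X x hX c h0 hstep hG hnI hmov
  refine ⟨n₁, fun n hn hbu hnone f hf Z' hZ' => ?_⟩
  rcases hdich R hRf hRa ν X x hX c h0 hstep hG hnI n hbu hnone (hH n) with
    ⟨C, P', Rf, _, u, h, φ, hcs, hframe⟩ | hsurf
  · -- CURVE centre: the dictionary hands the frame the ruled-birth datum; `NoRuledBirth3` forbids it from `n₁` on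
    have hē : (c n).geomDirDim = 3 := le_antisymm (Helpers.chain_geomDirDim_le hX h0 hstep n) (hG n)
    exact hn₁ n hn hbu hnone C P' hcs Rf _ u h φ hframe
      (hdict R hRf hRa ν X x hX (c n) (c (n + 1)) (reaches_chain h0 hstep n) (hstep n) hē hbu hnone C P' hcs f hf
        ⟨Z', hZ'⟩ Rf _ u h φ hframe)
  · -- SURFACE centre: the near fibre over `x_n` is at most a point, so nothing is born in it
    have hpt : (c (n + 1)).pt ∈ Scheme.hsStratum (c (n + 1)).W 3 ν := componentsIn.subset hZ'.1.1.1 hZ'.1.1.2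
    exact not_isFibreBirthAt_of_subsingleton_nearFibre (hsurf f hf)
      ((hinv (n + 1)).singleton_notMem_componentsIn_of_not_iso hpt (hnI (n + 1))) Z' hZ'

/-- [OURS · L1 W4.2] **NO LATE FIBRE BIRTHS at W-top, from the dictionary, `NoRuledBirth3` and the (unrestricted) cycle-end centre
dictionary `CycleEndCentreDichotomy3`** (every scope `Q`) — the composition BY NAME over res-type-067's p515936. CAVEAT (RULINGS v3.12-4
(X)): `CycleEndCentreDichotomy3` as typed also speaks at NON-hypersurface W-top stages, where it fails (witness `C₁ × C₂ × 𝔸¹`, two cusps);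
the honest hypersurface cell is `not_isFibreBirthAt_eventually_of_dictionary` with `H :=` the typer's `IsHypStage` once it lands.
NOT a statement of the manuscript. [folklore] -/
theorem strataCycleEndNoFibreBirths_three_of_dictionary {p : ℕ} (hdict : BirthDictionary3.{u} p)
    (hrec : NoRuledBirth3.{u} p) (hdich : CycleEndCentreDichotomy3.{u} p)
    (Q : ℕ → (ℕ → ℕ) → ∀ X : Scheme.{u}, X → Prop) :
    StrataCycleEndNoFibreBirths p 3 Q (fun s => 3 ≤ s.geomDirDim) := by
  intro R hRf hRa ν X _ x hX _hQ c h0 hstep hG hnI hmov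
  exact not_isFibreBirthAt_eventually_of_dictionary hdict hrec (fun _ => True)
    (fun R hRf hRa ν X _ x hX c h0 hstep hG hnI n hbu hnone _ => hdich R hRf hRa ν X x hX c h0 hstep hG hnI n hbu hnone)
    hRf hRa hX h0 hstep hG hnI hmov (fun _ => trivial)

/-- [OURS · L1 W4.2] **D9 CLOSE — row (b-end)₃ `StrataCycleEndBirthsSettle p 3 Q (3 ≤ ē)` from the three named claims and the
MOVING-births row** (067's join `strataCycleEndBirthsSettle_of_noFibre_noMoving`). NOT a statement of the manuscript. [folklore] -/
theorem strataCycleEndBirthsSettle_three_of_dictionary {p : ℕ} (hdict : BirthDictionary3.{u} p)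
    (hrec : NoRuledBirth3.{u} p) (hdich : CycleEndCentreDichotomy3.{u} p)
    (Q : ℕ → (ℕ → ℕ) → ∀ X : Scheme.{u}, X → Prop)
    (hmov : StrataCycleEndNoMovingBirths p 3 Q (fun s => 3 ≤ s.geomDirDim)) :
    StrataCycleEndBirthsSettle p 3 Q (fun s => 3 ≤ s.geomDirDim) :=
  strataCycleEndBirthsSettle_of_noFibre_noMoving (strataCycleEndNoFibreBirths_three_of_dictionary hdict hrec hdich Q) hmov

/-- [OURS · L1 W4.2] **D9 CLOSE in the shape of RULINGS v3.12-2 (J2)** (`QNe Q` scopes, `∀ Q`): dictionary ∧ no recurrent ruled births ∧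
dichotomy ⇒ (∀ Q, no late MOVING births at W-top) ⇒ (∀ Q, row (b-end)₃). NOT a statement of the manuscript. [folklore] -/
theorem strataCycleEndBirthsSettle_three_of_noRuled_noMoving {p : ℕ} (hdict : BirthDictionary3.{u} p)
    (hrec : NoRuledBirth3.{u} p) (hdich : CycleEndCentreDichotomy3.{u} p)
    (hmov : ∀ Q : ℕ → (ℕ → ℕ) → ∀ X : Scheme.{u}, X → Prop,
      StrataCycleEndNoMovingBirths p 3 (QNe Q) (fun s => 3 ≤ s.geomDirDim))
    (Q : ℕ → (ℕ → ℕ) → ∀ X : Scheme.{u}, X → Prop) :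
    StrataCycleEndBirthsSettle p 3 (QNe Q) (fun s => 3 ≤ s.geomDirDim) :=
  strataCycleEndBirthsSettle_three_of_dictionary hdict hrec hdich (QNe Q) (hmov Q)

end Summit.ResolutionOfSingularities.ResolutionOfSingularities.Theorems.SigmaMaxModificationsCorridor3.Moving

end
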